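import Literature.AnabelianGeometry.EtaleTheta.Discharge.Sec2LiftingSurjProofs
import Literature.AnabelianGeometry.EtaleTheta.Discharge.Sec2Prop214iiiMonoTranslations

/-!
# [EtTh] Def 2.13 (iii) bookkeeping for model bi-theta environments: inverses and composites of
# isomorphisms, and the `Gal(Y/X)`-conjugation `conjX g : B(η) ≃ B(g·η)` (proof-only companion)

Mochizuki, *The Étale Theta Function and its Frobenioid-theoretic Manifestations* [EtTh], Publ. RIMS 45
(2009), §2, Def 2.13 (iii) p.48 and Prop 2.14 (iii) pp.49–50 (locators `p.N` = PDF pages of the PRIMS text;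
bib key `MochizukiEtTh2009`). PROOF-ONLY companion (no `def`) of `MonoThetaEnv.lean` (`BiThetaEnv.Iso`,
`ThetaEnvData.modelBi`) — seat abc-iut-L2-t2, §2 owner; tools for the `{±1}`-part of Prop 2.14 (iii) in
the bi-theta case (`Discharge/Sec2BiThetaAutLift.lean`, `Discharge/Sec2Prop214iiiBiInversionOfModel.lean`).

* `ThetaEnvData.exists_modelBiIso_symm`, `…_trans` — "an isomorphism of bi-theta environments" (Def 2.13
  (iii): an isomorphism of topological groups mapping `D_Π ↦ D_{Π'}`, `s^Θ_Π ↦ s^Θ_{Π'}`, `s^alg_Π ↦ s^alg_{Π'}`)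
  between MODEL bi-theta environments `B(η)`, `B(η')`, `B(η'')` of one `ThetaEnvData` can be inverted and
  composed (stated as existence of an `Iso` with prescribed underlying map; no new definitions).
* `ThetaEnvData.exists_biIso_conjX_of_conj_eq` — for `g ∈ Π^tp_X` and theta cocycles `η`, `η'` with
  `χ(aug g) · η(g⁻¹ k g) = η'(k) · ∂c(k)` on `Π^tp_Ÿ` (the `g`-conjugate of `η` is `η'` up to a coboundary),
  the outer Galois automorphism `conjX g : (a, y) ↦ (χ(aug g) a, g y g⁻¹)` of `Π^tp_Y[μ_N]` (p.46) IS an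
  isomorphism `B(η) ≃ B(η')`: its class lies in `D_Y` (so it normalises `D_Y`), it carries `Im(s^Θ_η)` onto
  the `μ_N`-conjugate of `Im(s^Θ_{η'})` by `c⁻¹` and `Im(s^alg_Ÿ)` onto itself (`Π^tp_Ÿ ⊴ Π^tp_X`). For
  `η' = η` and `g ∈ N·(l·ℤ)` this is the translation part of Prop 2.14 (iii) (this seat's g2
  `ThetaEnvTower.exists_biIso_conjX`); for ARBITRARY `g` it transports automorphisms of `B(η)` to
  automorphisms of `B(g·η)` — how the lift of the inversion to ONE `B(η₀)` propagates to every `B(η)` of the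
  collection `η̈^{Θ,l·ℤ×μ₂}` (a `Π^tp_X`-orbit, Def 2.7 p.41).
HONEST FRAMING: [EtTh] is refereed; bookkeeping over the typed §2 interface only; no side is taken on
[IUTchIII] Cor 3.12; typed ≠ discharged elsewhere.
-/

namespace Literature.AnabelianGeometry.EtaleTheta

universe u

namespace ThetaEnvData

variable {N : ℕ+} (T : ThetaEnvData.{u} N)

/-! ## Inverses and composites of isomorphisms of model bi-theta environments -/

/-- The bi-continuous automorphism of `Π^tp_Y[μ_N]` underlying an isomorphism of model bi-theta
environments, as an element of `contMulAut`; transport along it is conjugation by its class in `Out`.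
[cite: MochizukiEtTh2009, Def 2.13(iii) p.48] -/
theorem map_D_conj_of_modelBiIso {η η' : T.PiYdd → T.mu} {hη : η ∈ T.thetaCocycles}
    {hη' : η' ∈ T.thetaCocycles} (α : (T.modelBi hη).Iso (T.modelBi hη')) :
    T.DY.map (MulAut.conj (TopOut.mk T.env
      ⟨α.e.toMulEquiv, α.e.continuous, α.e.symm.continuous⟩)).toMonoidHom = T.DY := by
  have h := α.map_D
  change T.DY.map (TopOut.transport α.e) = T.DY at h
  rwa [TopOut.transport_eq_conj] at h

/-- Images of sets of subgroups under an automorphism and its inverse.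
[cite: MochizukiEtTh2009, Def 2.13(iii) p.48] -/
theorem image_map_symm_eq_of_image_map_eq (e : T.env ≃ₜ* T.env) {S S' : Set (Subgroup T.env)}
    (h : (fun H : Subgroup T.env => H.map e.toMulEquiv.toMonoidHom) '' S = S') :
    (fun H : Subgroup T.env => H.map e.symm.toMulEquiv.toMonoidHom) '' S' = S := by
  have hcomp : e.symm.toMulEquiv.toMonoidHom.comp e.toMulEquiv.toMonoidHom = MonoidHom.id _ :=
    MonoidHom.ext fun x => e.symm_apply_apply x
  have hback : ∀ H : Subgroup T.env,
      (H.map e.toMulEquiv.toMonoidHom).map e.symm.toMulEquiv.toMonoidHom = H := fun H => by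
    rw [Subgroup.map_map, hcomp, Subgroup.map_id]
  rw [← h, Set.image_image]
  simp only [hback, Set.image_id']

/-- **Inverse of an isomorphism of model bi-theta environments** `B(η) ≃ B(η')` (Def 2.13 (iii)), with
underlying map the inverse map. [cite: MochizukiEtTh2009, Def 2.13(iii) p.48] -/
theorem exists_modelBiIso_symm {η η' : T.PiYdd → T.mu} {hη : η ∈ T.thetaCocycles}
    {hη' : η' ∈ T.thetaCocycles} (α : (T.modelBi hη).Iso (T.modelBi hη')) :
    ∃ γ : (T.modelBi hη').Iso (T.modelBi hη), ∀ x, γ.e x = α.e.symm x := by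
  set cα : contMulAut T.env := ⟨α.e.toMulEquiv, α.e.continuous, α.e.symm.continuous⟩ with hcα
  have hinv : (⟨α.e.symm.toMulEquiv, α.e.symm.continuous, α.e.symm.symm.continuous⟩ :
      contMulAut T.env) = cα⁻¹ := Subtype.ext rfl
  refine ⟨{ e := α.e.symm, map_D := ?_, map_sTheta := ?_, map_sAlg := ?_ }, fun x => rfl⟩
  · change T.DY.map (TopOut.transport α.e.symm) = T.DY
    rw [TopOut.transport_eq_conj, hinv, map_inv]
    exact (subgroup_map_conj_mul_inv _ (T.map_D_conj_of_modelBiIso α)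
      (T.map_D_conj_of_modelBiIso α)).2
  · exact T.image_map_symm_eq_of_image_map_eq α.e α.map_sTheta
  · exact T.image_map_symm_eq_of_image_map_eq α.e α.map_sAlg

/-- Images of sets of subgroups under a composite of automorphisms.
[cite: MochizukiEtTh2009, Def 2.13(iii) p.48] -/
theorem image_map_trans_eq (e e' : T.env ≃ₜ* T.env) {S S' S'' : Set (Subgroup T.env)}
    (h : (fun H : Subgroup T.env => H.map e.toMulEquiv.toMonoidHom) '' S = S')
    (h' : (fun H : Subgroup T.env => H.map e'.toMulEquiv.toMonoidHom) '' S' = S'') :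
    (fun H : Subgroup T.env => H.map (e.trans e').toMulEquiv.toMonoidHom) '' S = S'' := by
  have hfun : (fun H : Subgroup T.env => H.map (e.trans e').toMulEquiv.toMonoidHom) =
      (fun H : Subgroup T.env => H.map e'.toMulEquiv.toMonoidHom) ∘
        (fun H : Subgroup T.env => H.map e.toMulEquiv.toMonoidHom) := by
    funext H
    change _ = (H.map e.toMulEquiv.toMonoidHom).map e'.toMulEquiv.toMonoidHom
    rw [Subgroup.map_map]
    rfl
  rw [hfun, Set.image_comp, h, h']

/-- **Composite of isomorphisms of model bi-theta environments** `B(η) ≃ B(η') ≃ B(η'')` (Def 2.13 (iii)),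
with underlying map the composite map. [cite: MochizukiEtTh2009, Def 2.13(iii) p.48] -/
theorem exists_modelBiIso_trans {η η' η'' : T.PiYdd → T.mu} {hη : η ∈ T.thetaCocycles}
    {hη' : η' ∈ T.thetaCocycles} {hη'' : η'' ∈ T.thetaCocycles}
    (α : (T.modelBi hη).Iso (T.modelBi hη')) (β : (T.modelBi hη').Iso (T.modelBi hη'')) :
    ∃ γ : (T.modelBi hη).Iso (T.modelBi hη''), ∀ x, γ.e x = β.e (α.e x) := by
  set cα : contMulAut T.env := ⟨α.e.toMulEquiv, α.e.continuous, α.e.symm.continuous⟩ with hcα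
  set cβ : contMulAut T.env := ⟨β.e.toMulEquiv, β.e.continuous, β.e.symm.continuous⟩ with hcβ
  have hmul : (⟨(α.e.trans β.e).toMulEquiv, (α.e.trans β.e).continuous,
      (α.e.trans β.e).symm.continuous⟩ : contMulAut T.env) = cβ * cα :=
    Subtype.ext (MulEquiv.ext fun _ => rfl)
  refine ⟨{ e := α.e.trans β.e, map_D := ?_, map_sTheta := ?_, map_sAlg := ?_ }, fun x => rfl⟩
  · change T.DY.map (TopOut.transport (α.e.trans β.e)) = T.DY
    rw [TopOut.transport_eq_conj, hmul, map_mul]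
    exact (subgroup_map_conj_mul_inv _ (T.map_D_conj_of_modelBiIso β)
      (T.map_D_conj_of_modelBiIso α)).1
  · exact T.image_map_trans_eq α.e β.e α.map_sTheta β.map_sTheta
  · exact T.image_map_trans_eq α.e β.e α.map_sAlg β.map_sAlg

/-- **Conjugate of an automorphism**: an automorphism `α` of `B(η)` and an isomorphism `e : B(η) ≃ B(η')`
give the automorphism `e ∘ α ∘ e⁻¹` of `B(η')`. [cite: MochizukiEtTh2009, Def 2.13(iii) p.48] -/
theorem exists_modelBiIso_conj {η η' : T.PiYdd → T.mu} {hη : η ∈ T.thetaCocycles}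
    {hη' : η' ∈ T.thetaCocycles} (α : (T.modelBi hη).Iso (T.modelBi hη))
    (e : (T.modelBi hη).Iso (T.modelBi hη')) :
    ∃ γ : (T.modelBi hη').Iso (T.modelBi hη'), ∀ x, γ.e x = e.e (α.e (e.e.symm x)) := by
  obtain ⟨e', he'⟩ := T.exists_modelBiIso_symm e
  obtain ⟨γ₁, hγ₁⟩ := T.exists_modelBiIso_trans e' α
  obtain ⟨γ, hγ⟩ := T.exists_modelBiIso_trans γ₁ e
  exact ⟨γ, fun x => by rw [hγ, hγ₁, he']⟩

/-! ## `conjX g` as an isomorphism `B(η) ≃ B(η')` for `g·η = η'` up to a coboundary -/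

/-- `conjX g` maps the cyclotome onto itself: `conjX g (ι a) = ι(χ(aug g) a)`.
[cite: MochizukiEtTh2009, Def 2.13(i) p.47] -/
theorem conjX_inMu (g : T.PiX) (a : T.mu) :
    T.conjX g (CycEnvelope.inMu T.augY T.chi a) = CycEnvelope.inMu T.augY T.chi (T.chi (T.aug g) a) := by
  ext
  · simp [ThetaEnvData.conjX]
  · simp [ThetaEnvData.conjX]

/-- `conjX g` on the algebraic section: `conjX g (s^alg(k)) = s^alg(g k g⁻¹)`.
[cite: MochizukiEtTh2009, Def 2.13(i) p.47] -/
theorem conjX_sAlg (g : T.PiX) (k : T.PiYdd) :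
    T.conjX g (T.sAlg k) = T.sAlg ⟨g * k * g⁻¹, T.PiYdd_normal.conj_mem _ k.2 g⟩ := by
  ext
  · simp [ThetaEnvData.conjX, ThetaEnvData.sAlg]
  · rfl

/-- `conjX g` stabilises the image of the algebraic section (`Π^tp_Ÿ` is normal in `Π^tp_X`).
[cite: MochizukiEtTh2009, Def 2.13(iii) p.48] -/
theorem map_range_sAlg_conjX (g : T.PiX) :
    T.sAlg.range.map (T.conjX g).toMonoidHom = T.sAlg.range := by
  ext z
  constructor
  · rintro ⟨_, ⟨k, rfl⟩, rfl⟩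
    exact ⟨⟨g * k * g⁻¹, T.PiYdd_normal.conj_mem _ k.2 g⟩, (T.conjX_sAlg g k).symm⟩
  · rintro ⟨k, rfl⟩
    refine ⟨T.sAlg ⟨g⁻¹ * k * g⁻¹⁻¹, T.PiYdd_normal.conj_mem _ k.2 g⁻¹⟩, ⟨_, rfl⟩, ?_⟩
    change T.conjX g _ = _
    rw [T.conjX_sAlg g]
    congr 1
    apply Subtype.ext
    change g * (g⁻¹ * (k : T.PiX) * g⁻¹⁻¹) * g⁻¹ = k
    group

/-- **`conjX g` on theta sections when `g·η = η'` up to a coboundary**: if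
`χ(aug g)·η(g⁻¹ k g) = η'(k)·∂c(k)` on `Π^tp_Ÿ`, then `conjX g` carries `s^Θ_η(g⁻¹ k g)` to the
`μ_N`-conjugate `ι(c⁻¹) s^Θ_{η'}(k) ι(c⁻¹)⁻¹`. [cite: MochizukiEtTh2009, Prop 2.14(iii) p.50] -/
theorem conjX_sTheta_of_conj_eq {η η' : T.PiYdd → T.mu} (hη : η ∈ T.thetaCocycles)
    (hη' : η' ∈ T.thetaCocycles) (g : T.PiX) (c : T.mu)
    (hc : ∀ k : T.PiYdd, T.chi (T.aug g) (η ⟨g⁻¹ * k * g, by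
        simpa [mul_assoc] using T.PiYdd_normal.conj_mem _ k.2 g⁻¹⟩) =
      η' k * CycEnvelope.coboundary (T.aug.comp T.PiYdd.subtype) T.chi c k)
    (k : T.PiYdd) :
    T.conjX g (T.sTheta hη ⟨g⁻¹ * k * g, by
        simpa [mul_assoc] using T.PiYdd_normal.conj_mem _ k.2 g⁻¹⟩) =
      MulAut.conj (CycEnvelope.inMu T.augY T.chi c⁻¹) (T.sTheta hη' k) := by
  rw [CycEnvelope.conj_inMu_eq_shift_coboundary, CycEnvelope.shift_apply]
  ext
  · change T.chi (T.aug g) (η _)⁻¹ = (η' k)⁻¹ * CycEnvelope.coboundary T.augY T.chi c⁻¹ (T.inclYdd k)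
    rw [map_inv, hc k, mul_inv]
    congr 1
    change (c * (T.chi (T.aug (k : T.PiX)) c)⁻¹)⁻¹ = c⁻¹ * (T.chi (T.aug (k : T.PiX)) c⁻¹)⁻¹
    rw [mul_inv_rev, inv_inv, map_inv, inv_inv, mul_comm]
  · change g * (g⁻¹ * (k : T.PiX) * g) * g⁻¹ = (k : T.PiX)
    group

/-- Hence `conjX g` carries `Im(s^Θ_η)` onto a `μ_N`-conjugate of `Im(s^Θ_{η'})`.
[cite: MochizukiEtTh2009, Prop 2.14(iii) p.50] -/
theorem map_range_sTheta_conjX_of_conj_eq {η η' : T.PiYdd → T.mu} (hη : η ∈ T.thetaCocycles)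
    (hη' : η' ∈ T.thetaCocycles) (g : T.PiX) (c : T.mu)
    (hc : ∀ k : T.PiYdd, T.chi (T.aug g) (η ⟨g⁻¹ * k * g, by
        simpa [mul_assoc] using T.PiYdd_normal.conj_mem _ k.2 g⁻¹⟩) =
      η' k * CycEnvelope.coboundary (T.aug.comp T.PiYdd.subtype) T.chi c k) :
    (T.sTheta hη).range.map (T.conjX g).toMonoidHom =
      (T.sTheta hη').range.map (MulAut.conj (CycEnvelope.inMu T.augY T.chi c⁻¹)).toMonoidHom := by
  ext z
  constructor
  · rintro ⟨_, ⟨h, rfl⟩, rfl⟩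
    let k : T.PiYdd := ⟨g * h * g⁻¹, T.PiYdd_normal.conj_mem _ h.2 g⟩
    have e : T.sTheta hη ⟨g⁻¹ * k * g, by
        simpa [mul_assoc] using T.PiYdd_normal.conj_mem _ k.2 g⁻¹⟩ = T.sTheta hη h :=
      congrArg _ (Subtype.ext (by change g⁻¹ * (g * (h : T.PiX) * g⁻¹) * g = h; group))
    refine ⟨T.sTheta hη' k, ⟨k, rfl⟩, ?_⟩
    change MulAut.conj _ _ = T.conjX g (T.sTheta hη h)
    rw [← e, T.conjX_sTheta_of_conj_eq hη hη' g c hc k]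
  · rintro ⟨_, ⟨k, rfl⟩, rfl⟩
    exact ⟨T.sTheta hη ⟨g⁻¹ * k * g, by
        simpa [mul_assoc] using T.PiYdd_normal.conj_mem _ k.2 g⁻¹⟩, ⟨_, rfl⟩,
      T.conjX_sTheta_of_conj_eq hη hη' g c hc k⟩

/-- **`conjX g : B(η) ≃ B(η')` for `g·η = η'` up to a coboundary.** For `g ∈ Π^tp_X` and theta cocycles
`η`, `η'` with `χ(aug g)·η(g⁻¹ k g) = η'(k)·∂c(k)` on `Π^tp_Ÿ`, the automorphism `conjX g` of `Π^tp_Y[μ_N]`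
is an isomorphism of the model bi-theta environments `B(η) ≃ B(η')` (Def 2.13 (iii)): its class lies in
`D_Y`, it permutes `μ_N`, carries `[Im s^Θ_η]` to `[Im s^Θ_{η'}]` and `[Im s^alg]` to itself. For `η' = η`
this is the translation part of Prop 2.14 (iii); for arbitrary `g` it moves automorphisms between the
`B(η)` of one `Π^tp_X`-orbit. [cite: MochizukiEtTh2009, Prop 2.14(iii) p.50] -/
theorem exists_biIso_conjX_of_conj_eq {η η' : T.PiYdd → T.mu} (hη : η ∈ T.thetaCocycles)
    (hη' : η' ∈ T.thetaCocycles) (g : T.PiX) (c : T.mu)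
    (hc : ∀ k : T.PiYdd, T.chi (T.aug g) (η ⟨g⁻¹ * k * g, by
        simpa [mul_assoc] using T.PiYdd_normal.conj_mem _ k.2 g⁻¹⟩) =
      η' k * CycEnvelope.coboundary (T.aug.comp T.PiYdd.subtype) T.chi c k) :
    ∃ α : (T.modelBi hη).Iso (T.modelBi hη'), ∀ x, α.e x = T.conjX g x := by
  let κ : contMulAut T.env := ⟨T.conjX g, T.conjX_mem_contMulAut g⟩
  have hμ : ∀ a : T.mu, ∃ b : T.mu, (κ : MulAut T.env) (CycEnvelope.inMu T.augY T.chi a) =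
      CycEnvelope.inMu T.augY T.chi b := fun a => ⟨_, T.conjX_inMu g a⟩
  have hμ' : ∀ b : T.mu, ∃ a : T.mu, (κ : MulAut T.env) (CycEnvelope.inMu T.augY T.chi a) =
      CycEnvelope.inMu T.augY T.chi b := fun b =>
    ⟨(T.chi (T.aug g))⁻¹ b, by
      change T.conjX g _ = _
      rw [T.conjX_inMu g, MulAut.apply_inv_self]⟩
  refine ⟨{ e := ContinuousMulEquiv.mk (κ : MulAut T.env) κ.2.1 κ.2.2
            map_D := ?_, map_sTheta := ?_, map_sAlg := ?_ }, fun x => rfl⟩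
  · change T.DY.map (TopOut.transport _) = T.DY
    rw [TopOut.transport_mk_eq_conj]
    exact T.map_conj_DY_eq_of_mem (T.mk_conjX_mem_DY g)
  · change (fun H : Subgroup T.env => H.map (κ : MulAut T.env).toMonoidHom) ''
        CycEnvelope.muConjClass T.augY T.chi (T.sTheta hη).range =
      CycEnvelope.muConjClass T.augY T.chi (T.sTheta hη').range
    rw [CycEnvelope.image_muConjClass_eq_of_perm _ _ _ hμ hμ']
    change CycEnvelope.muConjClass T.augY T.chi ((T.sTheta hη).range.map (T.conjX g).toMonoidHom) = _
    rw [T.map_range_sTheta_conjX_of_conj_eq hη hη' g c hc, CycEnvelope.muConjClass_map_conj_inMu]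
  · change (fun H : Subgroup T.env => H.map (κ : MulAut T.env).toMonoidHom) ''
        CycEnvelope.muConjClass T.augY T.chi T.sAlg.range =
      CycEnvelope.muConjClass T.augY T.chi T.sAlg.range
    rw [CycEnvelope.image_muConjClass_eq_of_perm _ _ _ hμ hμ']
    change CycEnvelope.muConjClass T.augY T.chi (T.sAlg.range.map (T.conjX g).toMonoidHom) = _
    rw [T.map_range_sAlg_conjX g]

/-- **Transport of automorphisms along the orbit**: if `g·η₁ = η` up to a coboundary and `α₁` is an
automorphism of `B(η₁)` lying over the map `φ₁` on `Π^tp_Y`, then `conjX g ∘ α₁ ∘ (conjX g)⁻¹` is an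
automorphism of `B(η)` lying over `y ↦ g · φ₁(g⁻¹ y g) · g⁻¹`. [cite: MochizukiEtTh2009, Prop 2.14(iii) p.50] -/
theorem exists_biIso_over_conj_of_conj_eq {η₁ η : T.PiYdd → T.mu} (hη₁ : η₁ ∈ T.thetaCocycles)
    (hη : η ∈ T.thetaCocycles) (g : T.PiX) (c : T.mu)
    (hc : ∀ k : T.PiYdd, T.chi (T.aug g) (η₁ ⟨g⁻¹ * k * g, by
        simpa [mul_assoc] using T.PiYdd_normal.conj_mem _ k.2 g⁻¹⟩) =
      η k * CycEnvelope.coboundary (T.aug.comp T.PiYdd.subtype) T.chi c k)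
    (α₁ : (T.modelBi hη₁).Iso (T.modelBi hη₁)) (φ₁ : T.PiX → T.PiX)
    (hα₁ : ∀ x, ((CycEnvelope.proj T.augY T.chi (α₁.e x) : T.PiY) : T.PiX) =
      φ₁ (CycEnvelope.proj T.augY T.chi x : T.PiY)) :
    ∃ α : (T.modelBi hη).Iso (T.modelBi hη),
      ∀ x, ((CycEnvelope.proj T.augY T.chi (α.e x) : T.PiY) : T.PiX) =
        g * φ₁ (g⁻¹ * (CycEnvelope.proj T.augY T.chi x : T.PiY) * g) * g⁻¹ := by
  obtain ⟨e, he⟩ := T.exists_biIso_conjX_of_conj_eq hη₁ hη g c hc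
  obtain ⟨α, hα⟩ := T.exists_modelBiIso_conj α₁ e
  refine ⟨α, fun x => ?_⟩
  have hsymm : e.e.symm x = T.conjX g⁻¹ x := by
    apply e.e.injective
    rw [ContinuousMulEquiv.apply_symm_apply, he, ← T.conjX_symm, MulEquiv.apply_symm_apply]
  rw [hα, he, hsymm]
  change g * (((CycEnvelope.proj T.augY T.chi (α₁.e (T.conjX g⁻¹ x)) : T.PiY) : T.PiX)) * g⁻¹ = _
  rw [hα₁]
  change g * φ₁ (g⁻¹ * _ * g⁻¹⁻¹) * g⁻¹ = _
  rw [inv_inv]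
  rfl

end ThetaEnvData

end Literature.AnabelianGeometry.EtaleTheta
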